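import Summits.AtomisticToContinuum.Crystallization.Theorems.PalmUnimodularRigidityBenjaminiSchrammLimitEmbedding
import Summits.AtomisticToContinuum.Crystallization.Theorems.PalmUnimodularRigidityBenjaminiSchrammLimitContinuity
import Mathlib.Probability.Kernel.Composition.MeasureCompProd
import Mathlib.MeasureTheory.Measure.HasOuterApproxClosed
import Mathlib.MeasureTheory.Measure.ProbabilityMeasure
import Mathlib.MeasureTheory.Function.Floor
import Mathlib.MeasureTheory.Constructions.Polish.Basic
import Mathlib.Topology.UniformSpace.HeineCantor

/-!
# Benjamini–Schramm limit of ground states, III: Campbell measures and point-stationarity of limits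

Route `PalmUnimodularRigidity`, item `stmt-AtomisticToContinuum-9230` (`BenjaminiSchrammLimit`),
helper file 3. The Mecke / mass-transport identity `IsPointStationaryLaw` of a law `Q` of rooted
`δ`-hard-core configurations says that its CAMPBELL MEASURE `Q ⊗ₘ κ₀` (`κ₀ S = count|S`, a point
of the configuration attached to the configuration) is invariant under the re-rooting involution
`Θ (S, y) = (S - y, -y)`. Here:

* `isSFiniteKernel_toMeasure` — the counting-measure kernel is s-finite (uniform window bounds), so
  `Q ⊗ₘ κ₀` has the disintegration formulas of `Measure.compProd`;
* `exists_bcf_eq_lintegral` — tested against a continuous local `G`, the Campbell measure is the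
  `Q`-integral of a bounded continuous local sum (`continuous_integral_of_continuousOn`);
* `map_reroot_compProd_eq_of_tendsto` — **`Θ`-invariance of the Campbell measure passes to weak
  limits** `Qₙ → Q` on the compact configuration space: integrals of thickened indicators of closed
  sets bounded in the `E`-coordinate (a generating π-system on which both measures are locally
  finite) are limits along `Qₙ` of equal quantities;
* `isPointStationaryLaw_map_toMeasure` — a `Θ`-invariant Campbell measure gives, after pushing `Q`
  along the measurable embedding `S ↦ count|S`, a point-stationary law on `Measure (Measure E)`.

This is the closedness of unimodularity / point-stationarity under local weak (Benjamini–Schramm)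
limits (Aldous–Lyons 2007 §2; Heveling–Last 2005) for hard-core point configurations.
-/

noncomputable section

open MeasureTheory Set Filter Metric TopologicalSpace ProbabilityTheory
open scoped Topology ENNReal NNReal Classical BoundedContinuousFunction

namespace Summit.AtomisticToContinuum.Crystallization.Theorems.BenjaminiSchrammLimit

open Literature.Probability.Process Literature.Probability.Process.LocalConfig


variable {E : Type*} [NormedAddCommGroup E] [ProperSpace E] [MeasurableSpace E] [BorelSpace E]
  {δ : ℝ}

set_option quotPrecheck false in
/-- The incidence set `𝕄 = {(S, y) | y ∈ S}` of rooted hard-core configurations and their points. -/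
local notation "𝕄" => {p : RootedHardCoreConfig E δ × E | p.2 ∈ ((p.1.1 : LocalConfig E) : Set E)}

set_option quotPrecheck false in
/-- The re-rooting involution `Θ (S, y) = (S - y, -y)` of the Campbell measure (for `y ∈ S`; for
`y ∉ S` the junk value `(S, -y)`). -/
local notation "Θ" => fun p : RootedHardCoreConfig E δ × E =>
  ((if h : p.2 ∈ ((p.1.1 : LocalConfig E) : Set E) then p.1.reroot p.2 h else p.1 :
    RootedHardCoreConfig E δ), -p.2)

set_option quotPrecheck false in
/-- The counting-measure kernel `S ↦ count|S` from rooted `δ`-hard-core configurations to `E`; the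
Campbell measure of a law `Q` on configurations is `Q ⊗ₘ κ₀`. -/
local notation "κ₀" => (⟨fun S : RootedHardCoreConfig E δ => (S.1 : LocalConfig E).toMeasure,
  measurable_toMeasure (Fact.out : 0 < δ)⟩ : Kernel (RootedHardCoreConfig E δ) E)

/-! ### The counting-measure kernel is s-finite -/

omit [ProperSpace E] in
/-- **Uniform window bound**: for `δ > 0` and compact `W` there is `C` with `count|S (W) ≤ C` for
every rooted `δ`-hard-core configuration `S` (packing, `exists_forall_encard_inter_le`).
[folklore] -/
theorem exists_forall_toMeasure_le (hδ : 0 < δ) {W : Set E} (hW : IsCompact W) :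
    ∃ C : ℕ, ∀ S : RootedHardCoreConfig E δ, (S.1 : LocalConfig E).toMeasure W ≤ C := by
  obtain ⟨C, hC⟩ := exists_forall_encard_inter_le hδ hW
  refine ⟨C, fun S => ?_⟩
  rw [toMeasure_def, Measure.restrict_apply hW.measurableSet, Measure.count_apply
    (hW.measurableSet.inter (RootedHardCoreConfig.isClosed_coe hδ S).measurableSet)]
  exact (ENat.toENNReal_le.2 (hC _ S.2.2)).trans_eq (by simp)

/-- **The counting-measure kernel is s-finite** (`δ > 0`): it is the sum over the shells
`⌊‖y‖⌋ = n` of its restrictions, each a finite kernel by the uniform window bound. Hence the Campbell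
measure `Q ⊗ₘ κ₀` of a law `Q` has the usual disintegration formulas. [folklore] -/
theorem isSFiniteKernel_toMeasure [Fact (0 < δ)] : IsSFiniteKernel κ₀ := by
  have hδ : 0 < δ := Fact.out
  set A : ℕ → Set E := fun n => (fun y : E => ⌊‖y‖⌋₊) ⁻¹' {n} with hA_def
  have hAm : ∀ n, MeasurableSet (A n) := fun n =>
    (Nat.measurable_floor.comp measurable_norm) (measurableSet_singleton n)
  have hAd : Pairwise (Function.onFun Disjoint A) := fun m n hmn =>
    Set.disjoint_left.2 fun y (hym : ⌊‖y‖⌋₊ = m) (hyn : ⌊‖y‖⌋₊ = n) => hmn (hym.symm.trans hyn)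
  have hAU : (⋃ n, A n) = univ := iUnion_eq_univ_iff.2 fun y => ⟨⌊‖y‖⌋₊, rfl⟩
  have hAW : ∀ n : ℕ, A n ⊆ closedBall (0 : E) (n + 1) := fun n y (hy : ⌊‖y‖⌋₊ = n) => by
    rw [mem_closedBall_zero_iff]
    have := Nat.lt_floor_add_one ‖y‖
    rw [hy] at this
    exact this.le
  have hsum : κ₀ = Kernel.sum fun n => Kernel.restrict κ₀ (hAm n) := by
    refine Kernel.ext fun S => Measure.ext fun s hs => ?_
    rw [Kernel.sum_apply' _ _ hs]
    simp_rw [Kernel.restrict_apply' _ _ _ hs]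
    change (S.1 : LocalConfig E).toMeasure s = ∑' n, (S.1 : LocalConfig E).toMeasure (s ∩ A n)
    rw [← measure_iUnion (fun m n hmn => (hAd hmn).mono inter_subset_right inter_subset_right)
      fun n => hs.inter (hAm n), ← inter_iUnion, hAU, inter_univ]
  rw [hsum]
  haveI : ∀ n, IsFiniteKernel (Kernel.restrict κ₀ (hAm n)) := fun n => by
    obtain ⟨C, hC⟩ := exists_forall_toMeasure_le hδ (isCompact_closedBall (0 : E) (n + 1))
    refine ⟨⟨C, ENNReal.natCast_lt_top C, fun S => ?_⟩⟩
    rw [Kernel.restrict_apply' _ _ _ MeasurableSet.univ, univ_inter]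
    exact (measure_mono (hAW n)).trans (hC S)
  infer_instance

/-! ### Local sums as bounded continuous test functions -/

/-- The integral of an `ℝ≥0∞`-valued function vanishing off a compact set against `count|S` is the
finite sum over the points of `S` in the set. [folklore] -/
theorem lintegral_toMeasure_eq_finset_sum (S : RootedHardCoreConfig E δ) {f : E → ℝ≥0∞}
    {W : Set E} (hW : IsCompact W) (hf : ∀ x, x ∉ W → f x = 0)
    (hfin : (W ∩ ((S.1 : LocalConfig E) : Set E)).Finite) :
    ∫⁻ y, f y ∂((S.1 : LocalConfig E).toMeasure) = ∑ y ∈ hfin.toFinset, f y := by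
  have hsupp : Function.support f ⊆ W := fun x hx => by
    by_contra hxW
    exact hx (hf x hxW)
  rw [toMeasure_def, ← setLIntegral_eq_of_support_subset hsupp,
    Measure.restrict_restrict hW.measurableSet]
  conv_lhs => rw [← hfin.coe_toFinset]
  rw [lintegral_finset]
  simp only [Measure.count_singleton, mul_one]

/-- **Local sums of a continuous local function are bounded continuous.** For `δ > 0` and
`G : RootedHardCoreConfig E δ × E → ℝ≥0` continuous on the incidence set `𝕄` and vanishing for
`‖y‖ > R`, the local sum `S ↦ ∑_{y ∈ S} G(S, y)` is a bounded continuous function `A` on the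
compact configuration space, `A S = ∫⁻ G(S, ·) d(count|S)`. [folklore] -/
theorem exists_bcf_eq_lintegral (hδ : 0 < δ) {G : RootedHardCoreConfig E δ × E → ℝ≥0}
    (hGc : ContinuousOn G 𝕄) {R : ℝ} (hR : ∀ p : RootedHardCoreConfig E δ × E, R < ‖p.2‖ → G p = 0) :
    ∃ A : RootedHardCoreConfig E δ →ᵇ ℝ≥0, ∀ S : RootedHardCoreConfig E δ,
      (A S : ℝ≥0∞) = ∫⁻ y, (G (S, y) : ℝ≥0∞) ∂((S.1 : LocalConfig E).toMeasure) := by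
  haveI : Fact (0 < δ) := ⟨hδ⟩
  set a : RootedHardCoreConfig E δ → ℝ := fun S =>
    ∫ y, (G (S, y) : ℝ) ∂((S.1 : LocalConfig E).toMeasure) with ha_def
  have ha : Continuous a :=
    continuous_integral_of_continuousOn hδ (Ψ := fun p => (G p : ℝ)) (R := R)
      (NNReal.continuous_coe.comp_continuousOn hGc) fun p hp => by simp [hR p hp]
  refine ⟨BoundedContinuousFunction.mkOfCompact ⟨fun S => (a S).toNNReal,
    continuous_real_toNNReal.comp ha⟩, fun S => ?_⟩
  have hW : IsCompact (closedBall (0 : E) R) := isCompact_closedBall _ _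
  have hfin : (closedBall (0 : E) R ∩ ((S.1 : LocalConfig E) : Set E)).Finite :=
    finite_inter_of_separated hδ S.2.2 hW
  have hGW : ∀ x, x ∉ closedBall (0 : E) R → G (S, x) = 0 := fun x hx =>
    hR (S, x) (by rwa [mem_closedBall_zero_iff, not_le] at hx)
  change ((a S).toNNReal : ℝ≥0∞) = _
  rw [lintegral_toMeasure_eq_finset_sum S hW (fun x hx => by simp [hGW x hx]) hfin, ha_def]
  dsimp only
  rw [integral_toMeasure_eq_finset_sum S hW (fun x hx => by simp [hGW x hx]) hfin,
    ← ENNReal.ofReal, ENNReal.ofReal_sum_of_nonneg fun y _ => (G (S, y)).coe_nonneg]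
  simp only [ENNReal.ofReal_coe_nnreal]

/-! ### Invariance of the Campbell measure under re-rooting passes to weak limits -/

section Limit

variable [Fact (0 < δ)]

/-- The Campbell measure of a probability law gives finite mass to bounded windows. [folklore] -/
theorem compProd_univ_prod_closedBall_lt_top (Q : Measure (RootedHardCoreConfig E δ))
    [IsProbabilityMeasure Q] (r : ℝ) :
    haveI := isSFiniteKernel_toMeasure (E := E) (δ := δ)
    (Q ⊗ₘ κ₀) (univ ×ˢ closedBall (0 : E) r) < ∞ := by
  haveI := isSFiniteKernel_toMeasure (E := E) (δ := δ)
  obtain ⟨C, hC⟩ := exists_forall_toMeasure_le (Fact.out : 0 < δ) (isCompact_closedBall (0 : E) r)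
  rw [Measure.compProd_apply_prod MeasurableSet.univ measurableSet_closedBall, Measure.restrict_univ]
  calc ∫⁻ S, κ₀ S (closedBall (0 : E) r) ∂Q ≤ ∫⁻ _, (C : ℝ≥0∞) ∂Q := lintegral_mono fun S => hC S
    _ = C := by rw [lintegral_const, measure_univ, mul_one]
    _ < ∞ := ENNReal.natCast_lt_top C

/-- **Tested invariance passes to the limit.** If `Qₙ → Q` weakly and each Campbell measure
`Qₙ ⊗ₘ κ₀` is invariant under the re-rooting involution `Θ`, then `∫ Φ d(Θ_* (Q ⊗ₘ κ₀)) = ∫ Φ d(Q ⊗ₘ κ₀)`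
for every bounded continuous `Φ ≥ 0` vanishing for `‖y‖ > R`: both sides are integrals against
`Qₙ`, `Q` of bounded continuous local sums (`exists_bcf_eq_lintegral`). [folklore] -/
theorem lintegral_map_reroot_eq_of_tendsto {Qs : ℕ → ProbabilityMeasure (RootedHardCoreConfig E δ)}
    {Q : ProbabilityMeasure (RootedHardCoreConfig E δ)} (hlim : Tendsto Qs atTop (𝓝 Q))
    (hinv : ∀ n, haveI := isSFiniteKernel_toMeasure (E := E) (δ := δ)
      ((Qs n : Measure (RootedHardCoreConfig E δ)) ⊗ₘ κ₀).map Θ =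
        (Qs n : Measure (RootedHardCoreConfig E δ)) ⊗ₘ κ₀)
    (Φ : RootedHardCoreConfig E δ × E →ᵇ ℝ≥0) {R : ℝ}
    (hR : ∀ p : RootedHardCoreConfig E δ × E, R < ‖p.2‖ → Φ p = 0) :
    haveI := isSFiniteKernel_toMeasure (E := E) (δ := δ)
    ∫⁻ p, (Φ p : ℝ≥0∞) ∂(((Q : Measure (RootedHardCoreConfig E δ)) ⊗ₘ κ₀).map Θ) =
      ∫⁻ p, (Φ p : ℝ≥0∞) ∂((Q : Measure (RootedHardCoreConfig E δ)) ⊗ₘ κ₀) := by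
  haveI := isSFiniteKernel_toMeasure (E := E) (δ := δ)
  have hδ : 0 < δ := Fact.out
  have hΘ : Measurable Θ := measurable_reroot hδ
  have hΦm : Measurable fun p : RootedHardCoreConfig E δ × E => (Φ p : ℝ≥0∞) :=
    (ENNReal.continuous_coe.comp Φ.continuous).measurable
  -- the two local sums
  obtain ⟨A, hA⟩ := exists_bcf_eq_lintegral hδ (G := fun p => Φ p) Φ.continuous.continuousOn hR
  obtain ⟨B, hB⟩ := exists_bcf_eq_lintegral hδ (G := fun p => Φ (Θ p))
    (Φ.continuous.comp_continuousOn continuousOn_reroot) (R := R) fun p hp =>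
      hR _ (by dsimp only; rwa [norm_neg])
  have hIA : ∀ Q' : Measure (RootedHardCoreConfig E δ), IsProbabilityMeasure Q' →
      ∫⁻ p, (Φ p : ℝ≥0∞) ∂(Q' ⊗ₘ κ₀) = ∫⁻ S, (A S : ℝ≥0∞) ∂Q' := fun Q' _ => by
    rw [Measure.lintegral_compProd hΦm]
    exact lintegral_congr fun S => (hA S).symm
  have hIB : ∀ Q' : Measure (RootedHardCoreConfig E δ), IsProbabilityMeasure Q' →
      ∫⁻ p, (Φ p : ℝ≥0∞) ∂((Q' ⊗ₘ κ₀).map Θ) = ∫⁻ S, (B S : ℝ≥0∞) ∂Q' := fun Q' _ => by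
    rw [lintegral_map hΦm hΘ, Measure.lintegral_compProd (μ := Q') (κ := κ₀)
      (f := fun p => (Φ (Θ p) : ℝ≥0∞)) (hΦm.comp hΘ)]
    exact lintegral_congr fun S => (hB S).symm
  rw [hIA _ inferInstance, hIB _ inferInstance]
  have hlA := (ProbabilityMeasure.tendsto_iff_forall_lintegral_tendsto.1 hlim) A
  have hlB := (ProbabilityMeasure.tendsto_iff_forall_lintegral_tendsto.1 hlim) B
  refine tendsto_nhds_unique (hlB.congr fun n => ?_) hlA
  rw [← hIA _ inferInstance, ← hIB _ inferInstance, hinv n]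

/-- **Invariance of the Campbell measure under re-rooting passes to weak limits** (`δ > 0`, `E`
proper): if `Qₙ → Q` weakly on the compact space of rooted `δ`-hard-core configurations and every
`Qₙ ⊗ₘ κ₀` is `Θ`-invariant, so is `Q ⊗ₘ κ₀`. The closed sets bounded in the `E`-coordinate form a
generating π-system on which both (locally finite) measures are limits of integrals of thickened
indicators (`tendsto_lintegral_thickenedIndicator_of_isClosed`), equal by
`lintegral_map_reroot_eq_of_tendsto`. This is the closedness of point-stationarity (the Mecke /
mass-transport identity) under local weak limits. [folklore] -/
theorem map_reroot_compProd_eq_of_tendsto {Qs : ℕ → ProbabilityMeasure (RootedHardCoreConfig E δ)}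
    {Q : ProbabilityMeasure (RootedHardCoreConfig E δ)} (hlim : Tendsto Qs atTop (𝓝 Q))
    (hinv : ∀ n, haveI := isSFiniteKernel_toMeasure (E := E) (δ := δ)
      ((Qs n : Measure (RootedHardCoreConfig E δ)) ⊗ₘ κ₀).map Θ =
        (Qs n : Measure (RootedHardCoreConfig E δ)) ⊗ₘ κ₀) :
    haveI := isSFiniteKernel_toMeasure (E := E) (δ := δ)
    (((Q : Measure (RootedHardCoreConfig E δ)) ⊗ₘ κ₀).map Θ) =
      (Q : Measure (RootedHardCoreConfig E δ)) ⊗ₘ κ₀ := by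
  haveI := isSFiniteKernel_toMeasure (E := E) (δ := δ)
  have hδ : 0 < δ := Fact.out
  have hΘ : Measurable Θ := measurable_reroot hδ
  set C : Measure (RootedHardCoreConfig E δ × E) := (Q : Measure (RootedHardCoreConfig E δ)) ⊗ₘ κ₀
    with hC_def
  -- the generating π-system of closed sets bounded in the `E`-coordinate
  set 𝒮 : Set (Set (RootedHardCoreConfig E δ × E)) :=
    {F | IsClosed F ∧ ∃ R : ℝ, F ⊆ univ ×ˢ closedBall (0 : E) R} with h𝒮_def
  have hB : ∀ i : ℕ, (univ ×ˢ closedBall (0 : E) i : Set (RootedHardCoreConfig E δ × E)) ∈ 𝒮 :=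
    fun i => ⟨isClosed_univ.prod isClosed_closedBall, i, Subset.rfl⟩
  have hBU : (⋃ i : ℕ, (univ ×ˢ closedBall (0 : E) i : Set (RootedHardCoreConfig E δ × E))) = univ :=
    iUnion_eq_univ_iff.2 fun p => ⟨⌈‖p.2‖⌉₊, mem_univ _, mem_closedBall_zero_iff.2 (Nat.le_ceil _)⟩
  have hgen : (inferInstance : MeasurableSpace (RootedHardCoreConfig E δ × E)) =
      MeasurableSpace.generateFrom 𝒮 := by
    rw [BorelSpace.measurable_eq (α := RootedHardCoreConfig E δ × E), borel_eq_generateFrom_isClosed]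
    refine le_antisymm (MeasurableSpace.generateFrom_le fun F (hF : IsClosed F) => ?_)
      (MeasurableSpace.generateFrom_mono fun F hF => hF.1)
    have hFU : F = ⋃ i : ℕ, F ∩ univ ×ˢ closedBall (0 : E) i := by
      rw [← inter_iUnion, hBU, inter_univ]
    rw [hFU]
    exact MeasurableSet.iUnion fun i => MeasurableSpace.measurableSet_generateFrom
      ⟨hF.inter (hB i).1, i, inter_subset_right⟩
  have hpi : IsPiSystem 𝒮 := fun F hF F' hF' _ =>
    ⟨hF.1.inter hF'.1, hF.2.imp fun R hR => inter_subset_left.trans hR⟩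
  -- preimages of windows under `Θ`
  have hpre : ∀ r : ℝ, (Θ) ⁻¹' (univ ×ˢ closedBall (0 : E) r) =
      (univ ×ˢ closedBall (0 : E) r : Set (RootedHardCoreConfig E δ × E)) := fun r => by
    ext p
    simp only [mem_preimage, mem_prod, mem_univ, true_and, mem_closedBall_zero_iff, norm_neg]
  have hfinC : ∀ r : ℝ, C (univ ×ˢ closedBall (0 : E) r) < ∞ := fun r =>
    compProd_univ_prod_closedBall_lt_top _ r
  have hfinC' : ∀ r : ℝ, C.map Θ (univ ×ˢ closedBall (0 : E) r) < ∞ := fun r => by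
    rw [Measure.map_apply hΘ (MeasurableSet.univ.prod measurableSet_closedBall), hpre]
    exact hfinC r
  refine Measure.ext_of_generateFrom_of_iUnion 𝒮 (fun i : ℕ => univ ×ˢ closedBall (0 : E) i)
    hgen hpi hBU hB (fun i => (hfinC' i).ne) fun F hF => ?_
  obtain ⟨hFc, R, hFR⟩ := hF
  -- thickened indicators of `F`
  have hpos : ∀ m : ℕ, (0 : ℝ) < 1 / ((m : ℝ) + 1) := fun m => Nat.one_div_pos_of_nat
  set Φ : ℕ → (RootedHardCoreConfig E δ × E →ᵇ ℝ≥0) := fun m => thickenedIndicator (hpos m) F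
    with hΦ_def
  have hΦR : ∀ m, ∀ p : RootedHardCoreConfig E δ × E, R + 1 < ‖p.2‖ → Φ m p = 0 := by
    intro m p hp
    refine thickenedIndicator_zero (hpos m) F fun hmem => ?_
    obtain ⟨f, hf, hpf⟩ := mem_thickening_iff.1 hmem
    have hf2 : ‖f.2‖ ≤ R := mem_closedBall_zero_iff.1 (hFR hf).2
    have h1 : dist p f ≤ 1 := hpf.le.trans (by
      rw [div_le_one (by positivity)]; linarith [(Nat.cast_nonneg m : (0 : ℝ) ≤ m)])
    have h2 : dist p.2 f.2 ≤ dist p f := by rw [Prod.dist_eq]; exact le_max_right _ _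
    have h3 : ‖p.2‖ ≤ ‖f.2‖ + dist p.2 f.2 := by
      rw [dist_eq_norm]; linarith [norm_le_norm_add_norm_sub' p.2 f.2]
    linarith
  have hsupp : ∀ m, Function.support (fun p => (Φ m p : ℝ≥0∞)) ⊆
      univ ×ˢ closedBall (0 : E) (R + 1) := fun m p hp => by
    refine ⟨mem_univ _, mem_closedBall_zero_iff.2 (not_lt.1 fun hlt => hp ?_)⟩
    simp [hΦR m p hlt]
  have hFsub : F ⊆ univ ×ˢ closedBall (0 : E) (R + 1) := fun f hf =>
    ⟨mem_univ _, mem_closedBall_zero_iff.2 ((mem_closedBall_zero_iff.1 (hFR hf).2).trans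
      (by linarith))⟩
  -- for both measures, the integrals of `Φ m` converge to the measure of `F`
  have hlimit : ∀ ν : Measure (RootedHardCoreConfig E δ × E),
      ν (univ ×ˢ closedBall (0 : E) (R + 1)) < ∞ →
      Tendsto (fun m => ∫⁻ p, (Φ m p : ℝ≥0∞) ∂ν) atTop (𝓝 (ν F)) := by
    intro ν hν
    haveI : IsFiniteMeasure (ν.restrict (univ ×ˢ closedBall (0 : E) (R + 1))) :=
      ⟨by rw [Measure.restrict_apply_univ]; exact hν⟩
    have h := tendsto_lintegral_thickenedIndicator_of_isClosed
      (ν.restrict (univ ×ˢ closedBall (0 : E) (R + 1))) hFc hpos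
      tendsto_one_div_add_atTop_nhds_zero_nat
    rw [Measure.restrict_eq_self ν hFsub] at h
    refine h.congr fun m => ?_
    exact setLIntegral_eq_of_support_subset (hsupp m)
  refine tendsto_nhds_unique (hlimit _ (hfinC' _)) ?_
  have heq : ∀ m, ∫⁻ p, (Φ m p : ℝ≥0∞) ∂(C.map Θ) = ∫⁻ p, (Φ m p : ℝ≥0∞) ∂C := fun m =>
    lintegral_map_reroot_eq_of_tendsto hlim hinv (Φ m) (hΦR m)
  simp_rw [heq]
  exact hlimit _ (hfinC _)

end Limit

/-! ### Point-stationarity of the pushed-forward law -/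

section PointStationary

variable [NormedSpace ℝ E] [Fact (0 < δ)]

/-- **A `Θ`-invariant Campbell measure means a point-stationary law**: if the Campbell measure
`Q ⊗ₘ κ₀` of a law `Q` on rooted `δ`-hard-core configurations is invariant under the re-rooting
involution, then the push-forward of `Q` along the measurable embedding `S ↦ count|S` satisfies the
Mecke / mass-transport identity `IsPointStationaryLaw` (for `y ∈ S`, `count|(S - y) = θ_y count|S`).
[folklore] -/
theorem isPointStationaryLaw_map_toMeasure {Q : Measure (RootedHardCoreConfig E δ)}
    [IsProbabilityMeasure Q]
    (hinv : haveI := isSFiniteKernel_toMeasure (E := E) (δ := δ)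
      (Q ⊗ₘ κ₀).map Θ = Q ⊗ₘ κ₀) :
    IsPointStationaryLaw (Q.map fun S : RootedHardCoreConfig E δ => (S.1 : LocalConfig E).toMeasure) := by
  haveI := isSFiniteKernel_toMeasure (E := E) (δ := δ)
  have hδ : 0 < δ := Fact.out
  have hΘ : Measurable Θ := measurable_reroot hδ
  have hE := measurableEmbedding_toMeasure E (δ := δ)
  intro g hg
  rw [hE.lintegral_map, hE.lintegral_map]
  set F : RootedHardCoreConfig E δ × E → ℝ≥0∞ := fun p => g (p.1.1 : LocalConfig E).toMeasure p.2
    with hF_def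
  have hF : Measurable F := hg.comp (hE.measurable.prodMap measurable_id)
  calc ∫⁻ S, ∫⁻ y, g (S.1 : LocalConfig E).toMeasure y ∂(S.1 : LocalConfig E).toMeasure ∂Q
      = ∫⁻ p, F p ∂(Q ⊗ₘ κ₀) := (Measure.lintegral_compProd (μ := Q) (κ := κ₀) hF).symm
    _ = ∫⁻ p, F p ∂((Q ⊗ₘ κ₀).map Θ) := by rw [hinv]
    _ = ∫⁻ p, F (Θ p) ∂(Q ⊗ₘ κ₀) := lintegral_map hF hΘ
    _ = ∫⁻ S, ∫⁻ y, F (Θ (S, y)) ∂(S.1 : LocalConfig E).toMeasure ∂Q :=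
        Measure.lintegral_compProd (hF.comp hΘ)
    _ = ∫⁻ S, ∫⁻ y, g (((S.1 : LocalConfig E).toMeasure).map fun z => z - y) (-y)
          ∂(S.1 : LocalConfig E).toMeasure ∂Q := by
        refine lintegral_congr fun S => ?_
        rw [toMeasure_def]
        refine setLIntegral_congr_fun (RootedHardCoreConfig.isClosed_coe hδ S).measurableSet
          fun y hy => ?_
        simp only [hF_def, dif_pos hy]
        rw [RootedHardCoreConfig.toMeasure_reroot, toMeasure_def]

end PointStationary

end Summit.AtomisticToContinuum.Crystallization.Theorems.BenjaminiSchrammLimit
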